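/-
Copyright (c) 2026. All rights reserved.
Released under Apache 2.0 license as described in the file LICENSE.
Authors: abc-iut cell, seat abc-iut-w5-d053 (gen 4; row «COR36-FULL-NV» — a non-vacuity witness for the
residual hypothesis of the [AbsTopIII] Cor 3.6 / Cor 3.7 model column).
-/
import Literature.AnabelianGeometry.AbsoluteAnabelian.AbsTopIII.MLFGaloisModelAffineWitnessProofs
import Literature.AnabelianGeometry.AbsoluteAnabelian.AbsTopIII.FrobeniusPictureMLFModelInput
import Literature.AnabelianGeometry.AbsoluteAnabelian.AbsTopIII.FrobeniusPictureMLFShiftTelecoreCompatible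
import HarnessLib

/-!
# [AbsTopIII] Cor 3.6 / Cor 3.7 at the MLF model, NON-VACUOUSLY: Prop 3.2 (iv) surjectivity and
# id-rigidity HOLD on the nonempty type `P₀` of affine witness objects

S. Mochizuki, *Topics in absolute anabelian geometry III* [MochizukiAbsTopIII2015] (kurims manuscript
`paper:url-5493eb38cbb7`), Prop 3.2 (iv) p. 72; Cor 3.6 pp. 78–82; Cor 3.7 pp. 86–89.

PROOF-ONLY file (seat abc-iut-w5-d053 gen 4, row «COR36-FULL-NV»).  The Cor 3.6 / Cor 3.7 MODEL column of
the layer (abc-iut-L4-t5 / L4-t9 / L4-t12 / w5-d210 / w4-d095 / w5-d053 / w6-d023 / w6-d025 files) is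
unconditional MODULO one residual hypothesis on the type `P` of model objects — equivalently
`(P.ι ⋙ TFModel.gal p).Full` (Prop 3.2 (iv) surjectivity), the Cor-1.10 datum `AnabelianInput p P _`
(`nonempty_anabelianInput_iff_full`), or the lift datum `θ^bi` (`nonempty_biAnabelianLift_iff_full`) —
plus id-rigidity of `𝒳_P` for the (v)-clauses.  Before this file that hypothesis was inhabited only
VACUOUSLY (`AnabelianInput.ofEmpty`; `isEmpty_biAnabelianLift_modelSetting(Slim)`; `not_full_gal_slim`,
`isEmpty_anabelianInput_slim`).  Here, over the affine witness objects
`affineModel k = (ℚ̄_p ⋊ (ℚ̄_p^× ⋊ G_k) ↠ G_k ↷ ℚ̄_p)` of `MLFGaloisModelAffineWitness.lean`: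

* `isIdRigid_fullSubcategory_of_center_eq_bot` — Prop 3.2 (iv) id-rigidity of a full subcategory of `𝒳`
  needs only CENTRE-FREE `Π_k` (abc-iut-L4-t9's `isIdRigid_fullSubcategory_of_slim` asks slimness but its
  proof uses only `Z(Π_k) = 1`; same proof);
* `exists_hom_affineModel`, **`full_galP_isAffineModel`** — by the affine-group rigidity of the companion
  file, EVERY isomorphism of topological groups `Π₀(k₁) ⥲ Π₀(k₂)` is the Galois component of a
  Galois-isomorphism of pairs: **`Full` HOLDS on the NONEMPTY type `P₀ = IsAffineModel`**;
  **`isIdRigid_isAffineModel`** — `𝒳_{P₀}` is id-rigid;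
* `nonempty_anabelianInput_isAffineModel`, `nonempty_biAnabelianLift_isAffineModel`,
  `ker_and_galoisIsoLiftsToTFPairIso_isAffineModel` — the Cor-1.10 datum and `θ^bi` are INHABITED over
  `𝒳_{P₀}`, and the Prop 3.2 (iv) schema F-2995 `GaloisIsoLiftsToTFPairIsoOfStrictlyBelyi` holds at the
  nonempty predicate "is the pair of a `P₀`-object";
* `logFrobeniusCompatible_isAffineModel` (+ `logObsCompatCoresStmt_…`, `shiftCompatStmt_…`,
  `shiftTelecoreCompatStmt_isAffineModel`), `cor_3_7_isAffineModel` — **[AbsTopIII] Cor 3.6 (i)–(v) and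
  Cor 3.7 (i)–(v) hold at the sub-model `𝒳_{P₀}` with NO residual input** (Lemma 3.4, id-rigidity,
  fullness all theorems there).

HONEST FRAMING: `Π₀` is NOT of hyperbolic-orbicurve / strictly-Belyi type (neither profinite nor slim); this
is a CONSISTENCY / NON-VACUITY witness showing that the typed hypothesis structure of the model column —
«Prop 3.2 (iv) bijectivity ∧ id-rigidity ∧ Cor-1.10 datum» — is simultaneously satisfiable over GENUINE
MLF Galois groups `G_k`, NOT a model of [AbsTopIII] Cor 1.10 (whose `P` = "of strictly Belyi type" remains
campaign-L).  No new `Prop` fact (F-2995 is consumed BY NAME through abc-iut-L4-t9's iff); no definition;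
nothing here bears on [IUTchIII] Cor. 3.12; instantiated ≠ endorsed; model-level ≠ node-level.
-/

set_option autoImplicit false

noncomputable section

namespace Literature.AnabelianGeometry.AbsoluteAnabelian.AbsTopIII

open CategoryTheory
open Literature.AlgebraicGeometry.Frobenioids (IsSlimGroup)

variable {p : ℕ} [hp : Fact p.Prime]

namespace TFModel

/-! ## Prop 3.2 (iv) id-rigidity at the model needs only CENTRE-FREENESS of `Π_k` -/

namespace Hom

variable {A : TFModel p}

/-- **Step 1 of Prop 3.2 (iv) id-rigidity with `Π_k` merely CENTRE-FREE** (abc-iut-L4-t9's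
`homPi_eq_self_of_comm_innerAut` asks `Π_k` slim but uses only `Z(Π_k) = 1`): if an endomorphism
`a = (α, σ)` of `A` commutes with every inner automorphism then `g⁻¹α(g)` is central, so `α = id`.
[cite: MochizukiAbsTopIII2015, Proposition 3.2 (iv) p.72] -/
theorem homPi_eq_self_of_comm_innerAut_of_center_eq_bot (a : Hom A A)
    (hZ : Subgroup.center A.pair.Pi = ⊥)
    (hcomm : ∀ g : A.pair.Pi, A.innerAut g ≫ (show A ⟶ A from a) = (show A ⟶ A from a) ≫ A.innerAut g)
    (g : A.pair.Pi) : a.hom.homPi g = g := by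
  have hconj : ∀ g h : A.pair.Pi, a.hom.homPi (g * h * g⁻¹) = g * a.hom.homPi h * g⁻¹ := fun g h => by
    have e := congrArg (fun f : A ⟶ A => (f : Hom A A).hom.homPi h) (hcomm g)
    simp only [TFModel.comp_homPi_apply, innerAut_homPi_apply] at e
    exact e
  have hz : ∀ h : A.pair.Pi, h * (g⁻¹ * a.hom.homPi g) = (g⁻¹ * a.hom.homPi g) * h := by
    intro h
    obtain ⟨h', rfl⟩ := a.bijective.2 h
    have e := hconj g h'
    rw [map_mul, map_mul, map_inv] at e
    calc a.hom.homPi h' * (g⁻¹ * a.hom.homPi g)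
        = g⁻¹ * (g * a.hom.homPi h' * g⁻¹) * a.hom.homPi g := by group
      _ = g⁻¹ * (a.hom.homPi g * a.hom.homPi h' * (a.hom.homPi g)⁻¹) * a.hom.homPi g := by rw [e]
      _ = g⁻¹ * a.hom.homPi g * a.hom.homPi h' := by group
  have h1 : g⁻¹ * a.hom.homPi g = 1 := by
    have hmem : g⁻¹ * a.hom.homPi g ∈ Subgroup.center A.pair.Pi :=
      Subgroup.mem_center_iff.mpr fun h => hz h
    rw [hZ] at hmem
    exact (Subgroup.mem_bot).mp hmem
  calc a.hom.homPi g = g * (g⁻¹ * a.hom.homPi g) := by group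
    _ = g := by rw [h1, mul_one]

/-- **Prop 3.2 (iv) at one object, centre-free form**: an endomorphism of `A = (Π_k ↷ ℚ̄_p)` commuting
with all inner automorphisms is the identity as soon as `Z(Π_k) = 1` (field component: abc-iut-L4-t9's
`galois_eq_refl_of_homPi_eq_self`, slimness of `G_{ℚ_p}`). [cite: MochizukiAbsTopIII2015, Proposition 3.2 (iv) p.72] -/
theorem eq_id_of_comm_innerAut_of_center_eq_bot (a : A ⟶ A) (hZ : Subgroup.center A.pair.Pi = ⊥)
    (hcomm : ∀ g : A.pair.Pi, A.innerAut g ≫ a = a ≫ A.innerAut g) : a = 𝟙 A := by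
  have hPi := (a : Hom A A).homPi_eq_self_of_comm_innerAut_of_center_eq_bot hZ hcomm
  have hσ := (a : Hom A A).galois_eq_refl_of_homPi_eq_self hPi
  apply Hom.ext; apply GaloisFieldPair.Hom.ext
  · exact MonoidHom.ext hPi
  · ext x
    change (a : Hom A A).hom.homM x = x
    rw [← Hom.galois_apply, hσ, AlgEquiv.coe_refl, id]

end Hom

/-- **Every full subcategory of `𝒳` all of whose objects have CENTRE-FREE `Π_k` is id-rigid** (the
centre-free sharpening of abc-iut-L4-t9's `isIdRigid_fullSubcategory_of_slim`; same proof).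
[cite: MochizukiAbsTopIII2015, Proposition 3.2 (iv) p.72] -/
theorem isIdRigid_fullSubcategory_of_center_eq_bot (P : ObjectProperty (TFModel p))
    (hP : ∀ A : TFModel p, P A → Subgroup.center A.pair.Pi = ⊥) : IsIdRigid P.FullSubcategory := by
  refine isRigidFunctor_of_hom_app_eq_id fun η X => ?_
  apply P.hom_ext
  change (η.hom.app X).hom = 𝟙 X.obj
  refine Hom.eq_id_of_comm_innerAut_of_center_eq_bot _ (hP X.obj X.property) fun g => ?_
  have e := η.hom.naturality (ObjectProperty.homMk (X.obj.innerAut g) : X ⟶ X)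
  exact congrArg InducedCategory.Hom.hom e

/-! ## The affine witness: `Full` and `IsIdRigid` hold at the NONEMPTY type `P₀ = IsAffineModel` -/

section

variable {k : IntermediateField ℚ_[p] (PadicAlgCl p)} [FiniteDimensional ℚ_[p] k]

/-- The arithmetic kernel of the witness object is `ker ε` (`G_k` acts faithfully on `ℚ̄_p`).
[cite: MochizukiAbsTopIII2015, Definition 3.1 (ii) p.67] -/
theorem mem_actionKer_affineModel_iff (g : (affineModel k).pair.Pi) :
    g ∈ (affineModel k).pair.actionKer ↔ (show AffPi k from g).γ = 1 := by
  rw [GaloisFieldPair.actionKer, MonoidHom.mem_ker, RingEquiv.ext_iff, AlgEquiv.ext_iff]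
  exact Iff.rfl

end

section

variable {k₁ k₂ : IntermediateField ℚ_[p] (PadicAlgCl p)} [FiniteDimensional ℚ_[p] k₁]
  [FiniteDimensional ℚ_[p] k₂]

/-- **Every isomorphism of topological groups `Π₀(k₁) ⥲ Π₀(k₂)` is the Galois component of a
Galois-isomorphism of the witness objects** `(φ, σ) : affineModel k₁ ⟶ affineModel k₂` (`σ` from
`AffPi.exists_ringEquiv_of_mulEquiv`; kernels respected by `AffPi.γ_map_eq_one_iff`).
[cite: MochizukiAbsTopIII2015, Proposition 3.2 (iv) p.72] -/
theorem exists_hom_affineModel (φ : AffPi k₁ ≃ₜ* AffPi k₂) :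
    ∃ f : affineModel k₁ ⟶ affineModel k₂, ∀ x : AffPi k₁, (f : Hom _ _).hom.homPi x = φ x := by
  obtain ⟨σ, hσ⟩ := AffPi.exists_ringEquiv_of_mulEquiv φ.toMulEquiv
  refine ⟨{ hom :=
              { homPi := φ.toMulEquiv.toMonoidHom
                continuous_homPi := φ.continuous
                homM := σ.toRingHom
                smul_comm := fun g x => hσ g x
                comap_ker := by
                  ext g
                  rw [Subgroup.mem_comap, mem_actionKer_affineModel_iff, mem_actionKer_affineModel_iff]
                  exact AffPi.γ_map_eq_one_iff φ.toMulEquiv g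
                isOpen_image := fun U _ => by
                  change IsOpen (_ : Set (AffPi k₂))
                  exact isOpen_discrete _ }
            bijective := φ.bijective
            isOpenMap := φ.toHomeomorph.isOpenMap }, fun x => rfl⟩

end

/-- **Prop 3.2 (iv) SURJECTIVITY HOLDS on the nonempty type `P₀` of affine witness objects**:
`(Π ↷ ℚ̄_p) ↦ Π` is FULL on `𝒳_{P₀}` — the residual hypothesis of the Cor 3.6 / Cor 3.7 model column
(`biAnabelianLiftOfFull`, `model_of_cor_3_7_of_full`, `AnabelianInput.ofFull`), inhabited NON-VACUOUSLY.
[cite: MochizukiAbsTopIII2015, Proposition 3.2 (iv) p.72] -/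
theorem full_galP_isAffineModel : (galP p (IsAffineModel (p := p))).Full :=
  ⟨fun {X Y} g => by
    obtain ⟨A, k₁, hk₁, rfl⟩ := X
    obtain ⟨B, k₂, hk₂, rfl⟩ := Y
    obtain ⟨f, hf⟩ := exists_hom_affineModel (k₁ := k₁) (k₂ := k₂) (TopGroupObj.Hom.iso g)
    exact ⟨ObjectProperty.homMk f, TopGroupObj.Hom.ext fun x => hf x⟩⟩

/-- **`𝒳_{P₀}` is id-rigid** (`Π₀` is centre-free). [cite: MochizukiAbsTopIII2015, Proposition 3.2 (iv) p.72] -/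
theorem isIdRigid_isAffineModel : IsIdRigid (IsAffineModel (p := p)).FullSubcategory :=
  isIdRigid_fullSubcategory_of_center_eq_bot _ fun A hA => by
    obtain ⟨k, _, rfl⟩ := hA
    exact AffPi.center_eq_bot

/-- Honest scope: `Π₀(k)` is NOT slim (it is discrete, so `{1}` is an open subgroup with centraliser
everything) — the witness type `P₀` is disjoint from the slim type of abc-iut-L4-t9's `not_full_gal_slim` /
`isEmpty_anabelianInput_slim`, as it must be. [cite: MochizukiAbsTopIII2015, Proposition 3.2 (iv) p.72] -/
theorem not_isSlimGroup_affPi (k : IntermediateField ℚ_[p] (PadicAlgCl p)) : ¬ IsSlimGroup (AffPi k) := by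
  intro h
  have hbot := h.centralizer_eq_bot (⊥ : Subgroup (AffPi k)) (isOpen_discrete _)
  have hmem : (AffPi.tr 1 : AffPi k) ∈ Subgroup.centralizer ((⊥ : Subgroup (AffPi k)) : Set (AffPi k)) :=
    Subgroup.mem_centralizer_iff.mpr fun g hg => by
      rw [SetLike.mem_coe, Subgroup.mem_bot] at hg
      rw [hg, one_mul, mul_one]
  rw [hbot, Subgroup.mem_bot] at hmem
  exact one_ne_zero (congrArg AffPi.t hmem)

/-- **The Cor-1.10 input datum of Cor 3.6 is inhabited NON-VACUOUSLY** (over the nonempty `𝒳_{P₀}`; today's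
other instances: `AnabelianInput.ofEmpty`, and none over slim `P` by `isEmpty_anabelianInput_slim`).
[cite: MochizukiAbsTopIII2015, Corollary 3.6 (ii) p.79] -/
theorem nonempty_anabelianInput_isAffineModel :
    Nonempty (AnabelianInput p (IsAffineModel (p := p)) (IsAffineModel (p := p)).FullSubcategory) :=
  (nonempty_anabelianInput_iff_full p _).2 full_galP_isAffineModel

/-- **The bi-anabelian lift datum `θ^bi` of Cor 3.7 (ii) is inhabited NON-VACUOUSLY** (empty at both
previously available sub-models, `isEmpty_biAnabelianLift_modelSetting(Slim)`).
[cite: MochizukiAbsTopIII2015, Corollary 3.7 (ii) p.87] -/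
theorem nonempty_biAnabelianLift_isAffineModel :
    Nonempty (FiberSquare.BiAnabelianLift ((modelSetting p).restrict (IsAffineModel (p := p)) fun _ h => h).gal) :=
  ⟨biAnabelianLiftOfFull p _ full_galP_isAffineModel⟩

/-- **The printed residual in abc-iut-L4-t9's form HOLDS on `P₀`**: kernels of `Π ↠ Aut(ℚ̄_p)` are respected
by all isomorphisms of topological groups between `P₀`-objects, AND the Prop 3.2 (iv) `TF`-bijectivity
schema (F-2995 `GaloisIsoLiftsToTFPairIsoOfStrictlyBelyi`) holds at the predicate "is the pair of a
`P₀`-object" — an INSTANCE of the schema at a nonempty predicate (via `full_ι_gal_iff_ker_and_galoisIsoLiftsToTFPairIso`).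
[cite: MochizukiAbsTopIII2015, Proposition 3.2 (iv) p.72] -/
theorem ker_and_galoisIsoLiftsToTFPairIso_isAffineModel :
    (∀ A B : TFModel p, IsAffineModel A → IsAffineModel B → ∀ f : A.pair.Pi ≃ₜ* B.pair.Pi,
        A.pair.actionKer.map f.toMulEquiv.toMonoidHom = B.pair.actionKer) ∧
      GaloisIsoLiftsToTFPairIsoOfStrictlyBelyi
        (fun Q => ∃ A : TFModel p, IsAffineModel A ∧ A.pair = Q) :=
  (full_ι_gal_iff_ker_and_galoisIsoLiftsToTFPairIso _).mp full_galP_isAffineModel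

/-! ## [AbsTopIII] Cor 3.6 (i)–(v) and Cor 3.7 (i)–(v) at the nonempty sub-model `𝒳_{P₀}`, NO residual input -/

/-- **[AbsTopIII] Cor 3.6 (i)–(v) AT THE MODEL, NON-VACUOUSLY and WITHOUT RESIDUAL INPUT**: for the
witness type `P₀` and the datum `AnabelianInput.ofFull` the assembled typed `LogFrobeniusCompatible` holds
— (i) cores, (ii) telecore `𝔗_An`, (iii) observable `𝔖_log`, (iv) both incompatibilities (Lemma 3.4 at
the model), (v) nexus, total `□`-rigidity (id-rigidity of `𝒳_{P₀}`) and shifts.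
[cite: MochizukiAbsTopIII2015, Corollary 3.6 (i)–(v) pp.78–82] -/
theorem logFrobeniusCompatible_isAffineModel :
    (monoAnabelianData (AnabelianInput.ofFull p (IsAffineModel (p := p)) full_galP_isAffineModel)).toLogFrobeniusData.LogFrobeniusCompatible
      (monoAnabelianData (AnabelianInput.ofFull p (IsAffineModel (p := p)) full_galP_isAffineModel)).telecoreData :=
  (monoAnabelianData _).logFrobeniusCompatible (iotaTimesP p _) rfl (lemma34_model _)
    isIdRigid_isAffineModel ⟨affineModel ⊥, isAffineModel_affineModel ⊥⟩

/-- **[AbsTopIII] Cor 3.6 (iii), second clause (cores half) at `𝒳_{P₀}`** (abc-iut-w5-d053 gen 3's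
`logObsCompatCoresStmt_model`, now at a non-vacuous datum). [cite: MochizukiAbsTopIII2015, Corollary 3.6 (iii) p.80] -/
theorem logObsCompatCoresStmt_isAffineModel :
    (monoAnabelianData (AnabelianInput.ofFull p (IsAffineModel (p := p)) full_galP_isAffineModel)).toLogFrobeniusData.LogObsCompatCoresStmt :=
  logObsCompatCoresStmt_model _

/-- **[AbsTopIII] Cor 3.6 (v), third sentence at `𝒳_{P₀}`** (abc-iut-w6-d023's `shiftCompatStmt_model`).
[cite: MochizukiAbsTopIII2015, Corollary 3.6 (v) p.80] -/
theorem shiftCompatStmt_isAffineModel :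
    (monoAnabelianData (AnabelianInput.ofFull p (IsAffineModel (p := p)) full_galP_isAffineModel)).toLogFrobeniusData.ShiftCompatStmt :=
  shiftCompatStmt_model _

/-- **[AbsTopIII] Cor 3.6 (v), fourth sentence at `𝒳_{P₀}`** (abc-iut-w6-d025's `shiftTelecoreCompatStmt_model`).
[cite: MochizukiAbsTopIII2015, Corollary 3.6 (v) p.80] -/
theorem shiftTelecoreCompatStmt_isAffineModel :
    (monoAnabelianData (AnabelianInput.ofFull p (IsAffineModel (p := p)) full_galP_isAffineModel)).toLogFrobeniusData.ShiftTelecoreCompatStmt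
      (monoAnabelianData (AnabelianInput.ofFull p (IsAffineModel (p := p)) full_galP_isAffineModel)).telecoreData :=
  shiftTelecoreCompatStmt_model _

/-- **[AbsTopIII] Cor 3.7 (i)–(v) AT THE MODEL, NON-VACUOUSLY and WITHOUT RESIDUAL INPUT**: for the
`P₀`-sub-model and `θ^bi := biAnabelianLiftOfFull` — (i) cores, (ii) telecore with `θ^bi`, (iii)
observable, (iv) both incompatibilities (Lemma 3.4 at the object over `ℚ_p`), (v) nexus and total
`□`-rigidity (id-rigidity of `𝒳_{P₀}`) — abc-iut-w5-d210's `cor_3_7_of_inputs` with all three inputs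
DISCHARGED at `P₀`. [cite: MochizukiAbsTopIII2015, Corollary 3.7 (i)–(v) pp.86–89] -/
theorem cor_3_7_isAffineModel :
    ((modelSetting p).restrict (IsAffineModel (p := p)) fun _ h => h).Cor_3_7_i ∧
      ((modelSetting p).restrict (IsAffineModel (p := p)) fun _ h => h).Cor_3_7_ii
        (biAnabelianLiftOfFull p _ full_galP_isAffineModel) ∧
      Literature.AnabelianGeometry.AbsoluteAnabelian.AbsTopIII.BiAnabelianSetting.Cor_3_7_iii
        ((modelSetting p).restrict (IsAffineModel (p := p)) fun _ h => h) ∧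
      ((modelSetting p).restrict (IsAffineModel (p := p)) fun _ h => h).Cor_3_7_iv
        (biAnabelianLiftOfFull p _ full_galP_isAffineModel) ∧
      ((modelSetting p).restrict (IsAffineModel (p := p)) fun _ h => h).Cor_3_7_v :=
  ((modelSetting p).restrict (IsAffineModel (p := p)) fun _ h => h).cor_3_7_of_inputs _
    (model_of_logKernelObstruction p _ (affineModel ⊥) (isAffineModel_affineModel ⊥))
    isIdRigid_isAffineModel

end TFModel

end Literature.AnabelianGeometry.AbsoluteAnabelian.AbsTopIII

end
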